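import Literature.MathematicalPhysics.QuantumFieldTheory.Balaban1983to89.B3Ineq213ZeroBoxLines

/-!
# B3 (2.13) p. 426 — the vertex hypothesis of the localized lattice amplitudes DISCHARGED for concrete vertex functions:
# «The external fields are estimated further by the Hölder norms … in vertices we apply the inequalities |q| ≦ 1, |R_{n̄+1}(·)| ≦ 1»

T. Bałaban, *(Higgs)₂,₃ quantum fields in a finite volume. III. Renormalization*, Commun. Math. Phys. **88** (1983)
411–445 [Balaban1983Higgs3], Sect. 2, p. 426 [PDF 16]; the vertices (1.6)–(1.15) pp. 413–414 [PDF 3–4]; the orders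
`d_s(v)`, `d_v(v)` p. 420 [PDF 10] (journal page = PDF page + 410; held text
`paper:balaban1983-higgs-2-3-quantum-fields-finite-volume`).

statement-level skeleton of published theorems with citation tags; proofs where landed; nothing here is a claim about
the Yang–Mills mass gap

Cell `lit-balaban` (HOME `run/shared/lean/pub/lit-balaban/`), Phase-2 proof seat `lit-balaban-p03` gen 5, row
**B3.Eq2.13-2.14** (owner r15).  THEOREMS plus two definitions with bodies (`VertexFields.u`, `VertexFields.toVertexData`);
imports this seat's `B3Ineq213ZeroBoxLines` (the vertex-side datum `VertexData` of the zero-field box line class = p19's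
hypothesis (i) of `B3Ineq213.Amp`).  No new `def … : Prop`; no existing declaration is modified.

## What is printed

p. 426 [PDF 16]: *"We estimate it taking absolute values of all factors. The external fields are estimated further by the
Hölder norms … Finally in vertices we apply the inequalities |q| ≦ 1, |R_{n̄+1}(·)| ≦ 1."*; p. 420 [PDF 10]: *"Let us
denote by d_s(v) an order of the coupling constant λ for the vertex v, and by d_v(v) an order of the coupling constant e."*;
pp. 413–414: the vertices (1.6)–(1.15) are products of the couplings `e(L^kε)`, `λ(L^kε)`, powers of `η` (*"the proper
power of L^{j(v)}η"*, (2.14)), the legs (fields) and bounded tensors (`q` antisymmetric with `|q| ≦ 1`, the Taylor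
remainders `R_{n̄+1}`).

## What this file proves

p19's class `B3Ineq213.Amp` carries the vertex bound `u_le : |u_v(x)| ≤ e^{d_v(v)} λ^{d_s(v)} N^Φ_v N^A_v η^{e_v}` as a
HYPOTHESIS (file 3 of this seat packages it as the datum `VertexData.u_le`).  Here it is DISCHARGED for CONCRETE VERTEX
FUNCTIONS of the printed shape: `u_v(x) = e^{d_v(v)} · λ^{d_s(v)} · η^{e_v} · w_v(x) · Π_i (h_iΦ_i)(x) · Π_i (h′_iA_i)(x)`
(`VertexFields.u`) — couplings to their orders, the proper power of `η = L^{−k}`, a bounded tensor factor `|w_v| ≤ 1` (the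
`q`'s, `R_{n̄+1}`, numerical constants normalised into the couplings), and the EXTERNAL legs of the vertex = localized
external scalar / vector fields evaluated at the vertex position (the internal legs are the line kernels of `Amp`).  With
`N^Φ_v := Π_i S_i`, `N^A_v := Π_i T_i` for any bounds `S_i ≥ sup|h_iΦ_i|`, `T_i ≥ sup|h′_iA_i|` (e.g. the Hölder norms
`‖h_iΦ_i‖_{1,α₀} ≥ ‖·‖_∞`), **`VertexFields.abs_u_le`** is the printed estimate and **`VertexFields.toVertexData`** the
resulting vertex datum; fed into `boxAmp` / `dboxAmp` (files 3–4) it makes p19's (2.13) / (1.33) statements about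
EXPLICIT lattice sums of products of external fields and zero-field box propagators, with no hypothesis on lines or
vertices left (only Proposition 2.2's degree positivity, a property of the graph).

Scope: the shape of `u_v` is the common shape of (1.6)–(1.15) after *"taking absolute values of all factors"*; which legs
are external and the values of `d_v, d_s, e_v` per vertex type are the data rows B3.Eq1.6-1.11 / B3.Eq1.12-1.15
(`B3GraphData`), supplied here as numbers.
-/

namespace Literature.MathematicalPhysics.QuantumFieldTheory.Balaban1983to89.B3Ineq213Vertices

open Finset
open Literature.MathematicalPhysics.QuantumFieldTheory.Balaban1983to89.B3Ineq213ZeroBoxLines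

noncomputable section

variable {V : Type} [Fintype V] {d ℓ k : ℕ}

/-- **Concrete vertex data of a localized graph** (zero-field box line class, positions in η-units): per vertex `v`, its
`nS v` EXTERNAL scalar legs `Φ v i` and `nA v` external vector legs `A v i` (the localized external fields `h_iΦ_ext`,
`h′_iA_ext` as functions of the vertex position) with sup bounds `SΦ v i`, `SA v i` (*"estimated further by the Hölder
norms"*), a bounded tensor factor `w v` (*"|q| ≦ 1, |R_{n̄+1}(·)| ≦ 1"*), the orders `d_v(v)`, `d_s(v)` in the running
couplings `e(L^kε), λ(L^kε) ≥ 0`. [cite: Balaban1983Higgs3, (2.13) p.426, p.420] -/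
structure VertexFields (V : Type) [Fintype V] (d ℓ k : ℕ) where
  /-- number of external scalar legs of `v` -/
  nS : V → ℕ
  /-- number of external vector legs of `v` -/
  nA : V → ℕ
  /-- the localized external scalar fields on the legs of `v` -/
  Φ : (v : V) → Fin (nS v) → (Fin (d + 1) → ℕ) → ℝ
  /-- the localized external vector fields on the legs of `v` -/
  A : (v : V) → Fin (nA v) → (Fin (d + 1) → ℕ) → ℝ
  /-- sup bounds of the external scalar legs (e.g. their Hölder norms) -/
  SΦ : (v : V) → Fin (nS v) → ℝ
  /-- sup bounds of the external vector legs -/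
  SA : (v : V) → Fin (nA v) → ℝ
  SΦ_bound : ∀ v i x, |Φ v i x| ≤ SΦ v i
  SA_bound : ∀ v i x, |A v i x| ≤ SA v i
  /-- the bounded tensor / remainder factor of the vertex -/
  w : V → (Fin (d + 1) → ℕ) → ℝ
  w_le : ∀ v x, |w v x| ≤ 1
  /-- `e(L^kε)` -/
  eRun : ℝ
  /-- `λ(L^kε)` -/
  lamRun : ℝ
  eRun_nonneg : 0 ≤ eRun
  lamRun_nonneg : 0 ≤ lamRun
  /-- `d_v(v)` -/
  dv : V → ℕ
  /-- `d_s(v)` -/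
  ds : V → ℕ

namespace VertexFields

variable (F : VertexFields V d ℓ k) (etaPow : V → ℕ)

/-- `η = L^{−k}` as a real number (`L = ℓ + 1`). [cite: Balaban1983Higgs3, (2.10) p.426] -/
def η (_F : VertexFields V d ℓ k) : ℝ := ((((ℓ + 1 : ℕ) : ℝ)) ^ k)⁻¹

/-- `η > 0`. [cite: Balaban1983Higgs3, (2.10) p.426] -/
theorem η_pos : 0 < F.η := by
  unfold η; positivity

/-- **The concrete vertex function**: `u_v(x) = e^{d_v(v)} λ^{d_s(v)} η^{e_v} · w_v(x) · Π_i (h_iΦ_i)(x) · Π_i (h′_iA_i)(x)`.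
[cite: Balaban1983Higgs3, (1.6)–(1.15) pp.413–414, (2.13) p.426] -/
def u (v : V) (x : Fin (d + 1) → ℕ) : ℝ :=
  F.eRun ^ F.dv v * F.lamRun ^ F.ds v * F.η ^ (etaPow v : ℝ) * F.w v x * (∏ i, F.Φ v i x) * ∏ i, F.A v i x

/-- `N^Φ_v = Π_i S_i`. [cite: Balaban1983Higgs3, (2.13) p.426] -/
def NPhi (v : V) : ℝ := ∏ i, F.SΦ v i

/-- `N^A_v = Π_i T_i`. [cite: Balaban1983Higgs3, (2.13) p.426] -/
def NA (v : V) : ℝ := ∏ i, F.SA v i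

/-- the sup bounds are non-negative. [cite: Balaban1983Higgs3, (2.13) p.426] -/
theorem SΦ_nonneg (v : V) (i : Fin (F.nS v)) (x : Fin (d + 1) → ℕ) : 0 ≤ F.SΦ v i :=
  (abs_nonneg _).trans (F.SΦ_bound v i x)

/-- `N^Φ_v ≥ 0`. [cite: Balaban1983Higgs3, (2.13) p.426] -/
theorem NPhi_nonneg (v : V) : 0 ≤ F.NPhi v :=
  Finset.prod_nonneg fun i _ => (abs_nonneg _).trans (F.SΦ_bound v i fun _ => 0)

/-- `N^A_v ≥ 0`. [cite: Balaban1983Higgs3, (2.13) p.426] -/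
theorem NA_nonneg (v : V) : 0 ≤ F.NA v :=
  Finset.prod_nonneg fun i _ => (abs_nonneg _).trans (F.SA_bound v i fun _ => 0)

/-- the external scalar legs by their sup bounds: `|Π_i (h_iΦ_i)(x)| ≤ N^Φ_v`. [cite: Balaban1983Higgs3, (2.13) p.426] -/
theorem abs_prod_Φ_le (v : V) (x : Fin (d + 1) → ℕ) : |∏ i, F.Φ v i x| ≤ F.NPhi v := by
  rw [Finset.abs_prod]
  exact Finset.prod_le_prod (fun i _ => abs_nonneg _) fun i _ => F.SΦ_bound v i x

/-- the external vector legs by their sup bounds: `|Π_i (h′_iA_i)(x)| ≤ N^A_v`. [cite: Balaban1983Higgs3, (2.13) p.426] -/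
theorem abs_prod_A_le (v : V) (x : Fin (d + 1) → ℕ) : |∏ i, F.A v i x| ≤ F.NA v := by
  rw [Finset.abs_prod]
  exact Finset.prod_le_prod (fun i _ => abs_nonneg _) fun i _ => F.SA_bound v i x

/-- **The printed vertex estimate** (*"The external fields are estimated further by the Hölder norms … |q| ≦ 1, |R_{n̄+1}(·)| ≦ 1"*):
`|u_v(x)| ≤ e^{d_v(v)} λ^{d_s(v)} N^Φ_v N^A_v η^{e_v}` — p19's hypothesis (i) `Amp.u_le` for the concrete vertex functions.
[cite: Balaban1983Higgs3, (2.13) p.426] -/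
theorem abs_u_le (v : V) (x : Fin (d + 1) → ℕ) :
    |F.u etaPow v x| ≤ F.eRun ^ F.dv v * F.lamRun ^ F.ds v * F.NPhi v * F.NA v * F.η ^ (etaPow v : ℝ) := by
  unfold u
  have he : 0 ≤ F.eRun ^ F.dv v := pow_nonneg F.eRun_nonneg _
  have hl : 0 ≤ F.lamRun ^ F.ds v := pow_nonneg F.lamRun_nonneg _
  have hη : 0 ≤ F.η ^ (etaPow v : ℝ) := (Real.rpow_pos_of_pos F.η_pos _).le
  have hw := F.w_le v x
  have hΦ := F.abs_prod_Φ_le v x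
  have hA := F.abs_prod_A_le v x
  rw [abs_mul, abs_mul, abs_mul, abs_mul, abs_mul, abs_of_nonneg he, abs_of_nonneg hl, abs_of_nonneg hη]
  calc F.eRun ^ F.dv v * F.lamRun ^ F.ds v * F.η ^ (etaPow v : ℝ) * |F.w v x| * |∏ i, F.Φ v i x| * |∏ i, F.A v i x|
      ≤ F.eRun ^ F.dv v * F.lamRun ^ F.ds v * F.η ^ (etaPow v : ℝ) * 1 * F.NPhi v * F.NA v := by
        have hN : 0 ≤ F.eRun ^ F.dv v * F.lamRun ^ F.ds v * F.η ^ (etaPow v : ℝ) * 1 * F.NPhi v :=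
          mul_nonneg (mul_nonneg (mul_nonneg (mul_nonneg he hl) hη) zero_le_one) (F.NPhi_nonneg v)
        gcongr
    _ = F.eRun ^ F.dv v * F.lamRun ^ F.ds v * F.NPhi v * F.NA v * F.η ^ (etaPow v : ℝ) := by ring

/-- **The vertex datum of p19's class from concrete vertex functions** (hypothesis (i) discharged): `u := u_v`,
`N^Φ_v := Π S_i`, `N^A_v := Π T_i`, the orders and couplings as given. [cite: Balaban1983Higgs3, (2.13) p.426] -/
def toVertexData : VertexData V d ℓ k etaPow where
  u := F.u etaPow
  eRun := F.eRun
  lamRun := F.lamRun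
  dv := F.dv
  ds := F.ds
  NPhi := F.NPhi
  NA := F.NA
  eRun_nonneg := F.eRun_nonneg
  lamRun_nonneg := F.lamRun_nonneg
  NPhi_nonneg := F.NPhi_nonneg
  NA_nonneg := F.NA_nonneg
  u_le := fun v x => F.abs_u_le etaPow v x

/-- the vertex functions of the datum are the concrete ones. [cite: Balaban1983Higgs3, (2.13) p.426] -/
theorem toVertexData_u : (F.toVertexData etaPow).u = F.u etaPow := rfl

/-- the norms of the datum. [cite: Balaban1983Higgs3, (2.13) p.426] -/
theorem toVertexData_NPhi (v : V) : (F.toVertexData etaPow).NPhi v = ∏ i, F.SΦ v i := rfl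

end VertexFields

/-! ## Witness -/

/-- a vertex package on two vertices: one external scalar leg each (the constant field `1`, bound `1`), no vector legs,
`w = 1`, `e = λ = 1`, orders `d_v = 0`, `d_s = 1`. [cite: Balaban1983Higgs3, (2.13) p.426] -/
def twoVertexFields (d ℓ k : ℕ) : VertexFields (Fin 2) d ℓ k where
  nS := fun _ => 1
  nA := fun _ => 0
  Φ := fun _ _ _ => 1
  A := fun _ i _ => i.elim0
  SΦ := fun _ _ => 1
  SA := fun _ i => i.elim0
  SΦ_bound := fun _ _ _ => by simp
  SA_bound := fun _ i _ => i.elim0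
  w := fun _ _ => 1
  w_le := fun _ _ => by simp
  eRun := 1
  lamRun := 1
  eRun_nonneg := zero_le_one
  lamRun_nonneg := zero_le_one
  dv := fun _ => 0
  ds := fun _ => 1

/-- **Witness**: the concrete vertex functions give a vertex datum whose vertex function at `x` is `η^{e_v}` (here `e_v = 0`:
`u_v(x) = 1`), and which feeds the zero-field box amplitude `boxAmp` of the one-line graph (file 3).
[cite: Balaban1983Higgs3, (2.13) p.426] -/
theorem vertexFields_witness :
    ((twoVertexFields 2 1 1).toVertexData (fun _ => 0)).u 0 (fun _ => 0) = 1 ∧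
    ∃ A : B3Ineq213.Amp (boxCounts twoVertexGraph 2 1 le_rfl (1 / 2) 2 1 (by norm_num)).toModel,
      A.u = ((twoVertexFields 2 1 1).toVertexData twoVertexGraph.etaPow).u := by
  refine ⟨?_, boxAmp twoVertexGraph 2 1 le_rfl (1 / 2) 2 1 (by norm_num) (k := 1) le_rfl (a := 1) (m2 := 0)
    (by norm_num) (by norm_num) le_rfl (by norm_num) (fun _ => 1) (fun _ => le_rfl) (fun _ _ => 0)
    ((twoVertexFields 2 1 1).toVertexData twoVertexGraph.etaPow), rfl⟩
  simp [VertexFields.toVertexData, VertexFields.u, twoVertexFields]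

end

end Literature.MathematicalPhysics.QuantumFieldTheory.Balaban1983to89.B3Ineq213Vertices
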